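import Summits.BirchSwinnertonDyer.BirchSwinnertonDyer.Theorems.Rank1ResidualJetCebotarevAdapter
import Literature.NumberTheory.EllipticCurves.McCallum1991.EigenclassesCebotarevLevelPow
import HarnessLib

/-!
# T1 JET road K WITHOUT the `p`-adic tower — part 1: McCallum 1991 Cor. 3.2 at level `p^M` and Jetchev's
# Lemma 6.1 (`h61`) under `ρ̄_{E,p}` onto ONLY (width seat `bsd-wall-soed-p2-w2` g5; `--supports`, helper)

WHY. The road-K end forms `JET.jetchevDivisibilityCarrier{Ne,Mult,Add}_of_swapLiterature` (Jetchev 2008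
Thm. 1.4 at a bad prime `p ∣ N`, cell `bsd-jet`) carry the binder `∀ n, W.HasSurjectiveModNGaloisRep (p ^ n)`
(the `p`-adic tower) because the two McCallum reading facts they were first keyed to do; but every leaf use in
their kernel cone is `htower 1` (audit `Cruxes/WildKolyvaginUpperAtThree/SUBCELLS-JET-TOWER-w2g4.md` §2; McCallum
1991 §3 itself assumes only `Gal(ℚ(E_p)/ℚ) = GL₂(ℤ/p)`). At `p = 3` the tower does NOT follow from `ρ̄₃` onto
(Elkies 2006), and the SOED crux of record Ko′ `WildKolyvaginUpperAtThreeTowerFree` (stmt-24696) is tower-free,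
so its single-carrier sub-cell off the tower waits on tower-free end forms (p598295 §2 / p601995 display them as
`hJmax`). This series `Rank1ResidualJetModP*` re-issues the cone with `(hsurj : W.HasSurjectiveModNGaloisRep p)`
in place of the tower, decl by decl (suffix `_modP`, same namespaces, proofs = the originals with `htower 1 ↦
hsurj`; the reading facts `h32`/`h44` replaced by their mod-`p` derivations). Nothing of `bsd-jet`'s is edited.

THIS FILE: `cor32_eigenclasses_infinite_primes_localOrder_modP` — McCallum Cor. 3.2 at level `p^M` for
`τ`-eigenclasses with the tower binder replaced by `ρ̄_p` onto, PROVED exactly as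
`McCallum1991.cor32_eigenclasses_infinite_primes_localOrder_holds` (whose engine
`McCallum1991_cor_3_2_pow_of_chebotarev` takes the mod-`p` image only); and
`exists_kolyvaginPrime_addOrderOf_localization_eq_of_cor32_modP` — Jetchev's Lemma 6.1 in the localisation
currency (= `JET.exists_kolyvaginPrime_addOrderOf_localization_eq_of_cor32` with `h32` discharged and the tower
dropped). HONEST FRAMING: theorems only, no new definition, no named fact, no `sorry`; BSD is not proved by this file.
References: [cite: McCallumLMS1991, §3 Prop. 3.1, Cor. 3.2 (pp. 298–299)] [cite: Jetchev2008, Lemma 5.1 (p. 821)]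
[cite: Cha2005, Thm. 3, Thm. 7] [cite: Elkies2006, Introduction].
-/

set_option autoImplicit false

noncomputable section

open scoped Classical

open WeierstrassCurve IsDedekindDomain NumberField Literature.NumberTheory.EllipticCurves
  Literature.NumberTheory.EllipticCurves.ModularForms Literature.NumberTheory.GaloisRepresentations

namespace Summit.BirchSwinnertonDyer.Rank1Residual.JET

/-! ### McCallum Cor. 3.2 at level `p^M`, mod-`p` image -/

/-- **McCallum 1991, Cor. 3.2 at level `p^M` for `τ`-eigenclasses, under `ρ̄_{E,p}` onto ONLY** — the text of
the Literature fact `McCallum1991.cor32_eigenclasses_infinite_primes_localOrder` VERBATIM with its binder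
`(∀ n, W.HasSurjectiveModNGaloisRep (p ^ n))` replaced by `W.HasSurjectiveModNGaloisRep p`. Proof = the tree's
`cor32_eigenclasses_infinite_primes_localOrder_holds` (Čebotarev `chebotarev_artinRep_holds` + Weil pairing
`exists_weilPairing_holds` through `McCallum1991_cor_3_2_pow_of_chebotarev`, which is stated mod `p`).
[cite: McCallumLMS1991, §3 Prop. 3.1, Cor. 3.2 (pp. 298–299); §4 (pp. 299–300)] [cite: GrossLMS1991, §3 (3.1)–(3.3)] -/
theorem cor32_eigenclasses_infinite_primes_localOrder_modP :
    ∀ (N : ℕ) [NeZero N] (W : WeierstrassCurve ℚ) [W.IsElliptic] [W.IsGloballyMinimal],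
    ¬ W.HasCM →
    ∀ (K : Type) [Field K] [NumberField K], IsImaginaryQuadratic K →
    ∀ (p : ℕ), p.Prime → p ≠ 2 → W.HasSurjectiveModNGaloisRep p →
    ∀ (c : K ≃ₐ[ℚ] K), c ≠ 1 →
    ∀ (M : ℕ), 1 ≤ M →
    ∀ (r : ℕ) (cs : Fin r → galH1Torsion (W.baseChange K) ((p ^ M : ℕ) : ℤ)),
      (∀ i, cs i ≠ 0) →
      (∀ i, ∃ e : ℤ, (e = 1 ∨ e = -1) ∧ conjAct W c ((p ^ M : ℕ) : ℤ) (cs i) = e • cs i) →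
      (∀ a : Fin r → ℤ, ∑ i, a i • cs i = 0 → ∀ i, (addOrderOf (cs i) : ℤ) ∣ a i) →
    ∀ (Mi : Fin r → ℕ), (∀ i, addOrderOf (cs i) = p ^ Mi i) →
    ∀ (Nv : Fin r → ℕ), (∀ i, Nv i ≤ Mi i) →
      Set.Infinite {ℓ : ℕ | FrobEqFrobInfty W K (p ^ M) ℓ ∧
        Zhang2014.IsKolyvaginPrime N W K p ℓ ∧ M ≤ Zhang2014.kolyvaginIndex W p ℓ ∧
        ∀ i, ∀ v : HeightOneSpectrum (𝓞 K), (ℓ : 𝓞 K) ∈ v.asIdeal →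
          ∀ j : ℕ, ((p ^ j : ℕ) : ℤ) • cs i ∈
              (W.baseChange K).torsionLocalKer (v.adicCompletion K) ((p ^ M : ℕ) : ℤ) ↔
            Nv i ≤ j} := by
  intro N _ W _ _ _ K _ _ hK p hp hp2 hρ c hc M hM r cs h0 hτ hind Mi hMi Nv hNv
  haveI : Fact p.Prime := ⟨hp⟩
  have hW : W.exists_weilPairing p := W.exists_weilPairing_holds p
  -- `N_i ≤ M_i` as `p^{N_i - 1} c_i ≠ 0`
  have hN : ∀ i, Nv i ≠ 0 → ((p : ℤ) ^ (Nv i - 1)) • cs i ≠ 0 := by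
    intro i hi h
    have hdvd : addOrderOf (cs i) ∣ p ^ (Nv i - 1) := by
      apply addOrderOf_dvd_of_nsmul_eq_zero
      rw [← natCast_zsmul]
      exact_mod_cast h
    rw [hMi i, Nat.pow_dvd_pow_iff_le_right hp.one_lt] at hdvd
    have := hNv i
    omega
  -- independence in the `a_i c_i = 0` form
  have hind' : ∀ a : Fin r → ℤ, ∑ i, a i • cs i = 0 → ∀ i, a i • cs i = 0 := fun a ha i ↦
    addOrderOf_dvd_iff_zsmul_eq_zero.mp (hind a ha i)
  -- above every bound there is a good prime
  refine Set.infinite_of_forall_exists_gt fun b ↦ ?_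
  obtain ⟨ℓ, hbℓ, hKol, hfrob, hloc⟩ :=
    McCallum1991_cor_3_2_pow_of_chebotarev (W := W) (K := K) (N := N)
      Literature.NumberTheory.Automorphic.chebotarev_artinRep_holds hK hp hp2 hρ hW hM hc cs h0 Nv hN
      hτ hind' (max b (W.conductorNorm ℤ))
  obtain ⟨hℓP, hℓN, hℓD, hℓp, hprime, -⟩ := hKol
  have hbℓ' : b < ℓ := lt_of_le_of_lt (le_max_left _ _) hbℓ
  have hℓNE : ¬ ℓ ∣ W.conductorNorm ℤ := fun h ↦ by
    have := Nat.le_of_dvd (W.conductorNorm_pos_holds) h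
    have := lt_of_le_of_lt (le_max_right b _) hbℓ
    omega
  have hidx : M ≤ Zhang2014.kolyvaginIndex W p ℓ :=
    McCallum1991.le_kolyvaginIndex_of_frobEqFrobInfty W K hp hM hℓP hℓp hℓNE hfrob
  refine ⟨ℓ, ⟨hfrob, ⟨hℓP, hℓN, hℓD, hℓp, hprime, lt_of_lt_of_le (by omega) hidx⟩, hidx, ?_⟩, hbℓ'⟩
  intro i v hv j
  exact McCallum1991.forall_pow_zsmul_mem_iff_of_mem_of_not_mem _ (hloc i v hv).1 (hloc i v hv).2 j

/-! ### Jetchev's Lemma 6.1 in the localisation currency, mod-`p` image -/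

/-- **[J] Lemma 6.1 (= print Lemma 5.1 = [McC] Cor. 3.2) in the currency of the abstract Thm 6.3's
`h61`.** For `W/ℚ` (globally minimal, non-CM), `K` imaginary quadratic, `p` odd with the `p`-adic
tower, complex conjugation `τ ≠ 1`, a level `p^M` (`M ≥ 1`), a class `x` with `τx = e • x` and a
NON-ZERO class `y` with `τy = −e • y` (`e = ±1`) in `H¹(K, E[p^M])`, and any finite set `S` of rational
primes to avoid: there is a Kolyvagin prime `ℓ ∉ S` (for the free level `N`) of index `≥ M` such that
the localisation at the place `λ` of `K` above `ℓ` PRESERVES the orders of `x` and `y`: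
`addOrderOf (loc_λ x) = addOrderOf x`, `addOrderOf (loc_λ y) = addOrderOf y`
(`galoisCohomology.localization`, the Selmer-structure currency). From the typed fact
`McCallum1991.cor32_eigenclasses_infinite_primes_localOrder` with the system `(x, y)` (resp. `(y)` if
`x = 0`), independence by `dvd_of_zsmul_add_zsmul_eq_zero_of_eigen`, `N_i := M_i`, and the
dictionary `torsionLocalKer = ker loc_λ` (`mem_torsionLocalKer_iff_res_eq_zero`).
[cite: Jetchev2008, Lemma 5.1 (p. 821)] [cite: McCallumLMS1991, §3 Cor. 3.2 (p. 299)] -/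
theorem exists_kolyvaginPrime_addOrderOf_localization_eq_of_cor32_modP
    (N : ℕ) [NeZero N] (W : WeierstrassCurve ℚ) [W.IsElliptic] [W.IsGloballyMinimal]
    (hcm : ¬ W.HasCM) (K : Type) [Field K] [NumberField K] (hK : IsImaginaryQuadratic K)
    (p : ℕ) [Fact p.Prime] (hp2 : p ≠ 2) (hsurj : W.HasSurjectiveModNGaloisRep p)
    (τ : K ≃ₐ[ℚ] K) (hτ : τ ≠ 1) (M : ℕ) (hM : 1 ≤ M) {e : ℤ} (he : e = 1 ∨ e = -1)
    (x y : galH1Torsion (W.baseChange K) ((p ^ M : ℕ) : ℤ))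
    (hx : conjAct W τ ((p ^ M : ℕ) : ℤ) x = e • x) (hy : conjAct W τ ((p ^ M : ℕ) : ℤ) y = (-e) • y)
    (hy0 : y ≠ 0) (S : Finset ℕ) :
    ∃ ℓ : ℕ, ℓ ∉ S ∧ Zhang2014.IsKolyvaginPrime N W K p ℓ ∧ M ≤ Zhang2014.kolyvaginIndex W p ℓ ∧
      ∀ v : HeightOneSpectrum (𝓞 K), (ℓ : 𝓞 K) ∈ v.asIdeal →
        addOrderOf (galoisCohomology.localization
            ((W.baseChange K).torsionGaloisModule ((p ^ M : ℕ) : ℤ)) (Sum.inr v) 1 x) = addOrderOf x ∧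
        addOrderOf (galoisCohomology.localization
            ((W.baseChange K).torsionGaloisModule ((p ^ M : ℕ) : ℤ)) (Sum.inr v) 1 y) = addOrderOf y := by
  have hp : p.Prime := Fact.out
  -- every class is killed by `p^M`, so orders are powers of `p` (and prime to `2`)
  have hkill : ∀ z : galH1Torsion (W.baseChange K) ((p ^ M : ℕ) : ℤ), p ^ M • z = 0 := fun z ↦
    galoisCohomology.nsmul_eq_zero_of_forall ((W.baseChange K).torsionGaloisModule ((p ^ M : ℕ) : ℤ))
      (fun T ↦ by
        have h := (W.baseChange K).natAbs_nsmul_geomTorsion T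
        rwa [Int.natAbs_natCast] at h) z
  have hordpow : ∀ z : galH1Torsion (W.baseChange K) ((p ^ M : ℕ) : ℤ), ∃ k ≤ M, addOrderOf z = p ^ k :=
    fun z ↦ (Nat.dvd_prime_pow hp).mp (addOrderOf_dvd_of_nsmul_eq_zero (hkill z))
  have hcop2 : ∀ z : galH1Torsion (W.baseChange K) ((p ^ M : ℕ) : ℤ), (addOrderOf z).Coprime 2 := by
    intro z
    obtain ⟨k, -, hk⟩ := hordpow z
    rw [hk]
    exact Nat.Coprime.pow_left _ ((Nat.coprime_primes hp Nat.prime_two).mpr hp2)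
  -- the localisation at the place `v`, typed on `galH1Torsion` (= `galoisCohomology _ 1` by `rfl`)
  let loc : ∀ v : HeightOneSpectrum (𝓞 K), galH1Torsion (W.baseChange K) ((p ^ M : ℕ) : ℤ) →+
      galoisCohomology (((W.baseChange K).torsionGaloisModule ((p ^ M : ℕ) : ℤ)).toLocal (Sum.inr v)) 1 :=
    fun v ↦ galoisCohomology.localization ((W.baseChange K).torsionGaloisModule ((p ^ M : ℕ) : ℤ))
      (Sum.inr v) 1
  -- dictionary: multiples in `torsionLocalKer` = multiples killed by the localisation
  have hloc : ∀ (v : HeightOneSpectrum (𝓞 K)) (z : galH1Torsion (W.baseChange K) ((p ^ M : ℕ) : ℤ))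
      (j : ℕ), loc v (p ^ j • z) = 0 ↔
        ((p ^ j : ℕ) : ℤ) • z ∈ (W.baseChange K).torsionLocalKer (v.adicCompletion K) ((p ^ M : ℕ) : ℤ) := by
    intro v z j
    haveI : CharZero (v.adicCompletion K) := charZero_of_injective_algebraMap (algebraMap K _).injective
    rw [natCast_zsmul, mem_torsionLocalKer_iff_res_eq_zero (W := W.baseChange K)
      (E := v.adicCompletion K) (pow_ne_zero M hp.ne_zero)]
    exact Iff.rfl
  obtain ⟨b, -, hb⟩ := hordpow y
  have hey : (-e = 1 ∨ -e = -1) := by rcases he with rfl | rfl <;> norm_num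
  -- apply Cor 3.2 to an independent system of eigenclasses containing `y` (and `x` if `x ≠ 0`)
  have key : ∃ T : Set ℕ, T.Infinite ∧ ∀ ℓ ∈ T, Zhang2014.IsKolyvaginPrime N W K p ℓ ∧
      M ≤ Zhang2014.kolyvaginIndex W p ℓ ∧ ∀ v : HeightOneSpectrum (𝓞 K), (ℓ : 𝓞 K) ∈ v.asIdeal →
        addOrderOf (loc v x) = addOrderOf x ∧ addOrderOf (loc v y) = addOrderOf y := by
    by_cases hx0 : x = 0
    · -- the system `(y)`
      have hinf := cor32_eigenclasses_infinite_primes_localOrder_modP N W hcm K hK p hp hp2 hsurj τ hτ M hM 1 ![y]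
        (by intro i; fin_cases i; exact hy0)
        (by intro i; fin_cases i; exact ⟨-e, hey, hy⟩)
        (by
          intro a ha i
          fin_cases i
          have ha' : a 0 • y = 0 := by simpa using ha
          exact addOrderOf_dvd_iff_zsmul_eq_zero.mpr ha')
        ![b] (by intro i; fin_cases i; exact hb) ![b] (fun _ ↦ le_rfl)
      refine ⟨_, hinf, fun ℓ hℓ ↦ ⟨hℓ.2.1, hℓ.2.2.1, fun v hv ↦ ⟨by rw [hx0, map_zero, addOrderOf_zero, addOrderOf_zero], ?_⟩⟩⟩
      rw [hb]
      exact addOrderOf_map_eq_of_forall_map_nsmul_eq_zero_iff (loc v) hp fun j ↦ by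
        rw [hloc v y j]; simpa using hℓ.2.2.2 0 v hv j
    · -- the system `(x, y)`
      obtain ⟨a, -, ha⟩ := hordpow x
      have hinf := cor32_eigenclasses_infinite_primes_localOrder_modP N W hcm K hK p hp hp2 hsurj τ hτ M hM 2 ![x, y]
        (by
          intro i
          fin_cases i
          · exact hx0
          · exact hy0)
        (by
          intro i
          fin_cases i
          · exact ⟨e, he, hx⟩
          · exact ⟨-e, hey, hy⟩)
        (by
          intro c hc i
          have hc' : c 0 • x + c 1 • y = 0 := by simpa [Fin.sum_univ_two] using hc
          obtain ⟨h0, h1⟩ := dvd_of_zsmul_add_zsmul_eq_zero_of_eigen (conjAct W τ ((p ^ M : ℕ) : ℤ)) he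
            hx hy (hcop2 x) (hcop2 y) hc'
          fin_cases i
          · exact h0
          · exact h1)
        ![a, b]
        (by
          intro i
          fin_cases i
          · exact ha
          · exact hb)
        ![a, b] (fun _ ↦ le_rfl)
      refine ⟨_, hinf, fun ℓ hℓ ↦ ⟨hℓ.2.1, hℓ.2.2.1, fun v hv ↦ ⟨?_, ?_⟩⟩⟩
      · rw [ha]
        exact addOrderOf_map_eq_of_forall_map_nsmul_eq_zero_iff (loc v) hp fun j ↦ by
          rw [hloc v x j]; simpa using hℓ.2.2.2 0 v hv j
      · rw [hb]
        exact addOrderOf_map_eq_of_forall_map_nsmul_eq_zero_iff (loc v) hp fun j ↦ by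
          rw [hloc v y j]; simpa using hℓ.2.2.2 1 v hv j
  obtain ⟨T, hT, hTprop⟩ := key
  obtain ⟨ℓ, hℓT, hℓS⟩ := hT.exists_notMem_finset S
  exact ⟨ℓ, hℓS, hTprop ℓ hℓT⟩

end Summit.BirchSwinnertonDyer.Rank1Residual.JET

end
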